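import Mathlib
import HarnessLib
import Literature.Computability.AlgebraicComplexity.PatternExpressions
import Literature.Combinatorics.SimpleGraph.TreeDecomposition
import Summits.ValiantsHypothesis.ValiantsHypothesis.Theorems.MonotoneRestorationMonotoneRestorationQPLinearWidthSaturation

/-!
# Route MonotoneRestoration, crux `MonotoneRestorationQP` (stmt-15886), line `linear-width` —
# the saturating factor `Disc(row sums)²` vanishes on the whole invariant locus

Helper file (`--supports stmt-ValiantsHypothesis-15886`), def-free; a remark completing
`Theorems/…LinearWidthSaturation.lean` and `…LinearWidthForces.lean`.  Those files show that
`WidthRestorationQP` already yields quasi-polynomial-orbit square-symmetric circuits for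
`D_n · h_n`, `D_n = det(V(row sums))² · det(V(col sums))²`, for every matrix-symmetric `VP` family `h`; what
separates this from `OrbitRestorationQP` itself is EQUIVARIANT exact division by `D_n`.  The textbook
template — Strassen's elimination of divisions, i.e. inverting `D_n` as a truncated power series around a
base point `A₀` with `D_n(A₀) ≠ 0` — would have to use a base point fixed by the diagonal action of
`Sym_n` to stay square-symmetric, and this file records that no such base point exists: a point of
`ℂ^{n×n}` fixed by the diagonal action has all its row sums equal (`rowSum_eq_of_diagInvariant`), so for
`n ≥ 2` the row discriminant — hence `D_n` — vanishes there (`eval_discRowSq_eq_zero_of_diagInvariant`,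
`eval_discSq_mul_eq_zero_of_diagInvariant`).  (The saturating factor was chosen to vanish wherever colour
refinement cannot individualise; the invariant locus is the extreme case.)

Honest label: a remark on a registered stub's obstruction; no stub closed; VP ≠ VNP not moved.
-/

-- `Summit.ValiantsHypothesis.ValiantsHypothesis.…` is the tree's mandated namespace (Sub = Summit).
set_option linter.dupNamespace false

noncomputable section

namespace Summit.ValiantsHypothesis.ValiantsHypothesis.Theorems

namespace WidthSaturation

open Literature.Computability.AlgebraicComplexity MvPolynomial Matrix

/-- **A point fixed by the diagonal action of `Sym_n` has all row sums equal.** [folklore] -/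
theorem rowSum_eq_of_diagInvariant {n : ℕ} (A : Fin n × Fin n → ℂ)
    (hA : ∀ (σ : Equiv.Perm (Fin n)) (i j : Fin n), A (σ i, σ j) = A (i, j)) (u v : Fin n) :
    ∑ j, A (u, j) = ∑ j, A (v, j) := by
  calc ∑ j, A (u, j) = ∑ j, A (Equiv.swap u v u, Equiv.swap u v j) :=
        Finset.sum_congr rfl fun j _ => (hA (Equiv.swap u v) u j).symm
    _ = ∑ j, A (v, Equiv.swap u v j) := by simp
    _ = ∑ j, A (v, j) := Equiv.sum_comp (Equiv.swap u v) (fun j => A (v, j))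

/-- **A point fixed by the diagonal action of `Sym_n` has all column sums equal.** [folklore] -/
theorem colSum_eq_of_diagInvariant {n : ℕ} (A : Fin n × Fin n → ℂ)
    (hA : ∀ (σ : Equiv.Perm (Fin n)) (i j : Fin n), A (σ i, σ j) = A (i, j)) (u v : Fin n) :
    ∑ i, A (i, u) = ∑ i, A (i, v) := by
  calc ∑ i, A (i, u) = ∑ i, A (Equiv.swap u v i, Equiv.swap u v u) :=
        Finset.sum_congr rfl fun i _ => (hA (Equiv.swap u v) i u).symm
    _ = ∑ i, A (Equiv.swap u v i, v) := by simp
    _ = ∑ i, A (i, v) := Equiv.sum_comp (Equiv.swap u v) (fun i => A (i, v))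

/-- **The row discriminant vanishes on the invariant locus** (`n ≥ 2`). [folklore] -/
theorem eval_discRowSq_eq_zero_of_diagInvariant {n : ℕ} (hn : 2 ≤ n) (A : Fin n × Fin n → ℂ)
    (hA : ∀ (σ : Equiv.Perm (Fin n)) (i j : Fin n), A (σ i, σ j) = A (i, j)) :
    eval A (det (vandermonde fun u : Fin n => ∑ j : Fin n, (X (u, j) : MvPolynomial (Fin n × Fin n) ℂ)) ^ 2)
      = 0 := by
  rw [eval_discRowSq_eq_zero_iff]
  intro hinj
  have h01 : (⟨0, by omega⟩ : Fin n) = ⟨1, by omega⟩ :=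
    hinj (rowSum_eq_of_diagInvariant A hA ⟨0, by omega⟩ ⟨1, by omega⟩)
  simp [Fin.ext_iff] at h01

/-- **Hence the saturating factor `D_n · h_n` vanishes at every invariant base point** (`n ≥ 2`): no
`Sym_n`-fixed point of `ℂ^{n×n}` is available for an equivariant Taylor inversion of `D_n`. [folklore] -/
theorem eval_discSq_mul_eq_zero_of_diagInvariant {n : ℕ} (hn : 2 ≤ n) (A : Fin n × Fin n → ℂ)
    (hA : ∀ (σ : Equiv.Perm (Fin n)) (i j : Fin n), A (σ i, σ j) = A (i, j))
    (q : MvPolynomial (Fin n × Fin n) ℂ) :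
    eval A
        (det (vandermonde fun u : Fin n => ∑ j : Fin n, (X (u, j) : MvPolynomial (Fin n × Fin n) ℂ)) ^ 2 *
          det (vandermonde fun v : Fin n => ∑ i : Fin n, (X (i, v) : MvPolynomial (Fin n × Fin n) ℂ)) ^ 2 *
          q) = 0 := by
  rw [map_mul, map_mul, eval_discRowSq_eq_zero_of_diagInvariant hn A hA, zero_mul, zero_mul]

/-- The invariant locus is not empty and not trivial: the points `a·I + b·J` (e.g. the identity matrix)
are fixed by the diagonal action. [folklore] -/
theorem diagInvariant_of_scalar_add_const {n : ℕ} (a b : ℂ) (σ : Equiv.Perm (Fin n)) (i j : Fin n) :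
    (fun p : Fin n × Fin n => (if p.1 = p.2 then a else 0) + b) (σ i, σ j) =
      (fun p : Fin n × Fin n => (if p.1 = p.2 then a else 0) + b) (i, j) := by
  simp [σ.injective.eq_iff]

end WidthSaturation

end Summit.ValiantsHypothesis.ValiantsHypothesis.Theorems

end
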